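import Literature.MathematicalPhysics.QuantumFieldTheory.Balaban1983to89.Node00.Record12CarriersB12
import Literature.MathematicalPhysics.QuantumFieldTheory.Balaban1983to89.Node00.CarriersB13

/-!
# NODE 00 (YM-PLAN Track A) — STAGE 3′(X.B13) AT def-T's STAGE 12: the [B13] pin `Stage12Params.pinB13`, the SEVEN-pin Stage-12 views
# `view₁₂B13B12B8B10YZW` ∕ `view₁₂B13B12B8subB10YZW`, the cumulative records `IsRecordOfRecord₁₂CB10YZWB8B12B13 → IsRecordOfRecord₁₂CB10YZWB8B12` and
# `IsRecordOfRecord₁₂CB10YZWB8subB12B13 → IsRecordOfRecord₁₂CB10YZWB8subB12` (SAME datum, SAME world), and what N10 reads at such a record, by name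

NODE 00 DEFINER MODULE (seat `pub-ymgap-node00-def-B13` g2, 2026-08-26; director-ym R141 (A) row «`Node00/CarriersB13.lean`, term tower; N10 s1 pin half» — its ₁₂ LIFT:
seat node00-def g32's INTENT-27 «node00-def-B13: your `…B8B13` at ₁₂ lifts the same way», g0's HANDOFF trigger (t2); the R457 repair lane).  The restate of
`Node00/CarriersB13` §3–§4 with `11 ↦ 12` over g32's `Node00/Record12Carriers` ∕ `Record12CarriersRecords` ∕ `Record12CarriersB12` (def-T's `Node00/Record12` underneath):
def-T LOCATED that `Stage11Params.Provisos₁₁` is uninhabited (`Record12.not_provisos₁₁`, `not_isRecordOfRecord₁₁C`), so EVERY Stage-11 record predicate —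
`IsRecordOfRecord₁₁CB10YZWB8B12B13` included — is vacuous and its content re-lands HERE, at the repaired Stage-12 record.  The θ₃-keyed §1–§2 of `CarriersB13` (`ResidB13`,
`WtOfRecord`, `c13OfRecord`, `B13LeafOfRecord`, `withB13OfRecord`, `XB13OfRecord`, the Stage-5 `rebindX` faces, the honesty pair) are stage-free and CONSUMED BY NAME; nothing
below is edited (APPEND-ONLY: a NEW importing module).  PLUS the sub-family [B8′] twin (g0's trigger (t1), done at ₁₂ where it is not vacuous): the seven-pin view over g32's
`pinB8Sub` and `IsRecordOfRecord₁₂CB10YZWB8subB12B13`, with OLD ⇒ NEW from the full-family record.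
[Balaban1988RG2Cluster] = T. Bałaban, *Renormalization group approach to lattice gauge field theories. II. Cluster expansions*, Commun. Math. Phys. **116** (1988) 1–22;
[Balaban1989LargeFieldII] = Commun. Math. Phys. **122** (1989) 355–392; [Balaban1988Convergent] = Commun. Math. Phys. **119** (1988) 243–285.

WHAT IS DEFINED ∕ PROVED (kernel bookkeeping, 0 sorry).  §1 the pin `Stage12Params.pinB13 θ lam := θ.rebindX (XB13OfRecord θ.toStage3Params lam θ.res.X)` (g32's generic
Stage-12 re-binding — the lineage's kernel lesson 7: no structure pin, only `rebindX` with def-headed faces): `pinB13_X` (`rfl`), `_admissible_iff` (`Iff.rfl`), `_toStage3Params ∕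
_toStage9Params` (`rfl`), `pinB13_toStage11` (`rfl`: the pin commutes with def-T's Stage-11 view run by run), `F12OfRecord₁₂_pinB13 ∕ b12LeafOfRecord₁₂_pinB13_iff ∕ WOfRecord₁₂_pinB13` (`rfl`: the sibling's frame of record and the [IV] bundle read no carrier
of `X`), `Provisos₁₂.pinB13` (`Provisos₁₂.rebindX`), `toStage5₁₂_pinB13` (`toStage5₁₂_rebindX`), **`datumOfRecord₁₂_pinB13`** (UP-SIDE, `datumOfRecord₁₂_rebindX`), and N10 BY
NAME at the C-binding of the pinned Stage-12 view (`b13_main_iff_toStage5₁₂_pinB13`, `b13_main_at_toStage5₁₂_pinB13` = `CarriersB13` §2 at `φ := θ.toStage5₁₂`).  §2 the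
SEVEN-PIN views `view₁₂B13B12B8B10YZW θ lam13 lam12 lam8 … := (θ.pinB13 lam13).view₁₂B12B8B10YZW lam12 lam8 …` and `view₁₂B13B12B8subB10YZW … := (θ.pinB13
lam13).view₁₂B12B8subB10YZW …` ([B13] innermost, so every earlier face is g32's face at `θ.pinB13 lam13` BY NAME) and their leaves (`b13 : Iff.rfl` + g32's six).
§3 **`IsRecordOfRecord₁₂CB10YZWB8B12B13 D w`** := g32's `IsRecordOfRecord₁₂CB10YZWB8B12` VERBATIM with the [B13] layer added; `exists_world_…` ∕ `exists_…` (inhabitation =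
`₁₂C`'s, i.e. K0′'s — not touched here); **`isRecordOfRecord₁₂CB10YZWB8B12_of_isRecordOfRecord₁₂CB10YZWB8B12B13`** (SAME D, SAME w), `…B8_of_…`, `exists_isRecordOfRecord₁₂C_of_…`
(g31 ∕ g32's companion chain), `b4_b5_b6_b7_of_…`, `…_rebind_of_isRecordOfRecord₁₂C`, `leaves_iff_of_…` (seven leaves), `leaf_b13_iff_of_…`, `b13_main_iff_of_…` («b9 → b10 →
b11 → b12 → B13LeafOfRecord»), `b13_main_iff_bundles_of_…`, `b13_main_of_…_of_slots`; HONESTY AT THE RECORD (dag-ref-B READ-371 A2, made kernel):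
**`exists_isRecordOfRecord₁₂CB10YZWB8B12B13_forall_b13`** and **`…_forall_not_b13`** — over EVERY admissible Stage-12 package with provisos there is a record world of this
module whose `b13` HOLDS at every run (EMPTY spaces, `CarriersB13.exists_residB13_b13LeafOfRecord`) and one whose `b13` FAILS at every run (`GaugeInv := False`,
`exists_residB13_not_b13LeafOfRecord`): the leaf at a record is decided by the HIDDEN layer, so a count through this record needs the layer DISPLAYED and checked
non-degenerate (def-T's `TermTowerOfRecord` ∕ a `Provisos₁₂`-level law — NOT in the tree; NO law is put into this data pin, by the lineage's soundness lesson).  §4 the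
[B8′] twin: `IsRecordOfRecord₁₂CB10YZWB8subB12B13`, `→ IsRecordOfRecord₁₂CB10YZWB8subB12` (SAME D, SAME w), `exists_isRecordOfRecord₁₂C_of_…`, `b4_b5_b6_b7_of_…`,
`leaves_iff_of_…` (`b8 ↔ B8LeafOfRecordSub`), `leaf_b13_iff_of_…`, `b13_main_iff_bundles_of_…`, `b13_main_of_…_of_slots`, `…_rebind_of_isRecordOfRecord₁₂C`, and OLD ⇒ NEW
**`exists_isRecordOfRecord₁₂CB10YZWB8subB12B13_of_isRecordOfRecord₁₂CB10YZWB8B12B13`** (same datum; leaves equal off `b8`; new `b8` implied by the old).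
§5 HONESTY, SHARPENED (ref-B READ-373 (i) «non-degeneracy as law fields»): **`exists_residB13_b13LeafOfRecord_univ_of_nonneg`** — for ANY letters with non-negative
printed prefactors (print's are positive) the ZERO term tower with FULL spaces `sp1 = sp2 = univ` and the constancy invariance clause satisfies Lemma 1 ∧ 2 ∧ 3 AS TYPED at
every `θ₃` (sums of no terms are the zero function; every bound reads `0 ≤ prefactor·exp`); `…_univ` (letters 0); at the record: **`exists_isRecordOfRecord₁₂CB10YZWB8B12B13_
forall_b13_univ`**.  Reading: non-emptiness of the spaces ∕ a genuine (I.3.29) clause ∕ positive letters do NOT exclude the junk inhabitant — contentfulness of `b13` at a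
record is the IDENTIFICATION of the terms with the record's expansion ((1.25)–(1.33), (1.41), (2.9)–(2.14) at the record's effective actions: a term tower OF RECORD, a
CONSTRUCTION keyed on `Stage12Params`, NOT in the tree — g0 HANDOFF (t4), def-T's `TermTowerOfRecord`), not a `Prop`-law over `ResidB13`'s displayed fields.

HONEST FRAMING: definitions + kernel bookkeeping (`rfl` ∕ `Iff.rfl` ∕ transport); NO estimate; nothing of Bałaban's asserted or constructed; N10 NOT discharged (nor
N05 ∕ N07 ∕ N08 ∕ N09); counts unmoved; K0′ (`Record12` inhabitation) not touched; one finite T⁴ programme at fixed ε, Bałaban as printed — NOT continuum ∕ ℝ⁴ ∕ infinite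
volume ∕ OS ∕ mass gap ∕ Clay.  No `sorry`, no `axiom`, no `opaque`, no `instance` declaration, no `notation`. -/

noncomputable section

namespace Literature.MathematicalPhysics.QuantumFieldTheory.Balaban1983to89.Node00

open T4Continuum AveragingRT T4FiniteEpsInhabited FlowStep FlowStepRuns DagBinding T4DatumAssembly
open B8LeafKnitRS (B8LeafRS)
open scoped Matrix.Norms.L2Operator
open Literature.MathematicalPhysics.QuantumFieldTheory.Balaban1983to89.TreeLengthTorus (TDom TPt tsys IsTDom)
open Literature.MathematicalPhysics.QuantumFieldTheory.Balaban1983to89.B13Lemma3TorusTerms (terms)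
open Literature.MathematicalPhysics.QuantumFieldTheory.Balaban1983to89.B13PkScaling (Qop scaled)

/-! ## §1. The [B13] pin at Stage 12 (an `X`-re-binding through `Record12Carriers.Stage12Params.rebindX`, UP-SIDE) and N10 at the pinned Stage-12 view, BY NAME -/

section Pin12

variable (F : T4Family) (N : ℕ) [NeZero N]

/-- **The [B13] pin of Stage-12 parameters**: `res.X := XB13OfRecord θ.toStage3Params lam res.X`, everything else unchanged (g32's generic Stage-12 `rebindX`, as the sibling [B12]
pin `Stage12Params.pinB12`). [cite: Balaban1988RG2Cluster, Lemmas 1–3 pp.9–20 (objects of record, Stage 3′(X.B13))] -/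
def Stage12Params.pinB13 (θ : Stage12Params F N) (lam : B12.RunParams → ResidB13 θ.toStage3Params) : Stage12Params F N :=
  θ.rebindX F N (XB13OfRecord θ.toStage3Params lam θ.res.X)

/-- The pinned carrier family, unfolded (`rfl`). [cite: Balaban1988RG2Cluster, Lemmas 1–3 (bookkeeping)] -/
theorem Stage12Params.pinB13_X (θ : Stage12Params F N) (lam : B12.RunParams → ResidB13 θ.toStage3Params) (P : B12.RunParams) :
    (θ.pinB13 F N lam).res.X P = (θ.res.X P).withB13OfRecord θ.toStage3Params (lam P) := rfl

/-- The pin touches neither admissibility (`Iff.rfl`) … [cite: Balaban1987RG1, (1.20)–(1.21) p.264 (hypothesis dictionary; bookkeeping)] -/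
theorem Stage12Params.pinB13_admissible_iff (θ : Stage12Params F N) (lam : B12.RunParams → ResidB13 θ.toStage3Params) :
    (θ.pinB13 F N lam).Admissible F N ↔ θ.Admissible F N := Iff.rfl

/-- … nor the Stage-3 dictionary (`rfl`) … [cite: Balaban1984PropagatorsII, pp.223–250 (bookkeeping)] -/
theorem Stage12Params.pinB13_toStage3Params (θ : Stage12Params F N) (lam : B12.RunParams → ResidB13 θ.toStage3Params) :
    (θ.pinB13 F N lam).toStage3Params = θ.toStage3Params := rfl

/-- … nor the Stage-9 part but `res.X` (`rfl`, `Record11CarriersB12.Stage9Params.rebindX`) … [cite: Balaban1988Convergent, p.244 (bookkeeping)] -/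
theorem Stage12Params.pinB13_toStage9Params (θ : Stage12Params F N) (lam : B12.RunParams → ResidB13 θ.toStage3Params) :
    (θ.pinB13 F N lam).toStage9Params = θ.toStage9Params.rebindX F N (XB13OfRecord θ.toStage3Params lam θ.res.X) := rfl

/-- … and it COMMUTES WITH def-T's Stage-11 view run by run (`rfl`): `(θ.pinB13 lam).toStage11 p = (θ.toStage11 p).pinB13 lam` — so every `Stage11Params.pinB13`-keyed face of
`CarriersB13` §3 re-instantiates at the view of a [B13]-pinned Stage-12 parameter BY NAME. [cite: Balaban1988Convergent, (2.21) p.258 (bookkeeping)] -/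
theorem Stage12Params.pinB13_toStage11 (θ : Stage12Params F N) (lam : B12.RunParams → ResidB13 θ.toStage3Params) (p : B12.RunParams) :
    (θ.pinB13 F N lam).toStage11 F N p = (θ.toStage11 F N p).pinB13 F N lam := rfl

/-- … nor the sibling's [B12] frame of record at Stage 12 (`rfl`: it reads `Rz`, `s2`, `τ9`, not `X`) … [cite: Balaban1987RG1, Lemma 4 (3.53) p.280 (bookkeeping)] -/
theorem F12OfRecord₁₂_pinB13 (θ : Stage12Params F N) (lam : B12.RunParams → ResidB13 θ.toStage3Params) (lam12 : ResidB12 F N θ.τ9.M) (p : B12.RunParams) :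
    F12OfRecord₁₂ F N (θ.pinB13 F N lam) lam12 p = F12OfRecord₁₂ F N θ lam12 p := rfl

/-- … nor its `b12` leaf of record (`Iff.rfl`) … [cite: Balaban1987RG1, Lemma 4 (3.53) p.280 (bookkeeping)] -/
theorem b12LeafOfRecord₁₂_pinB13_iff (θ : Stage12Params F N) (lam : B12.RunParams → ResidB13 θ.toStage3Params) (lam12 : ResidB12 F N θ.τ9.M) (p : B12.RunParams) :
    B12LeafOfRecord₁₂ F N (θ.pinB13 F N lam) lam12 p ↔ B12LeafOfRecord₁₂ F N θ lam12 p := Iff.rfl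

/-- … nor the [IV] bundle of record (`rfl`). [cite: Balaban1989LargeFieldI, (0.2) p.176 (bookkeeping)] -/
theorem WOfRecord₁₂_pinB13 (θ : Stage12Params F N) (lam : B12.RunParams → ResidB13 θ.toStage3Params) (lamW : ResidW F N) :
    WOfRecord₁₂ F N (θ.pinB13 F N lam) lamW = WOfRecord₁₂ F N θ lamW := rfl

variable {F N} in
/-- The Stage-12 provisos transport along the [B13] pin (`Record12Carriers.Stage12Params.Provisos₁₂.rebindX`: they read no carrier). [cite: Balaban1988Convergent, (2.23)–(2.42) pp.259–262 (bookkeeping)] -/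
theorem Stage12Params.Provisos₁₂.pinB13 {θ : Stage12Params F N} (h : θ.Provisos₁₂ F N) (lam : B12.RunParams → ResidB13 θ.toStage3Params) :
    (θ.pinB13 F N lam).Provisos₁₂ F N :=
  h.rebindX _

/-- The Stage-12 view of [B13]-pinned parameters IS the re-bound Stage-12 view (g32's `toStage5₁₂_rebindX`). [cite: Balaban1988Convergent, p.244 (bookkeeping)] -/
theorem Stage12Params.toStage5₁₂_pinB13 (θ : Stage12Params F N) (lam : B12.RunParams → ResidB13 θ.toStage3Params) :
    (θ.pinB13 F N lam).toStage5₁₂ F N = (θ.toStage5₁₂ F N).rebindX F N (XB13OfRecord θ.toStage3Params lam θ.res.X) :=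
  Stage12Params.toStage5₁₂_rebindX F N θ _

/-- THE PIN IS UP-SIDE: the datum of record is unchanged (g32's `datumOfRecord₁₂_rebindX`). [cite: Balaban1989LargeFieldII, Thm 1 + (0.1) pp.355–356 (bookkeeping)] -/
theorem datumOfRecord₁₂_pinB13 (θ : Stage12Params F N) (h : θ.Provisos₁₂ F N) (lam : B12.RunParams → ResidB13 θ.toStage3Params) :
    datumOfRecord₁₂ F N (θ.pinB13 F N lam) (h.pinB13 lam) = datumOfRecord₁₂ F N θ h :=
  datumOfRecord₁₂_rebindX F N θ h _ (h.pinB13 lam)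

variable {F N}

/-- **N10 AT A RUN BOUND TO THE C-BINDING OF THE [B13]-PINNED STAGE-12 VIEW** (`CarriersB13.b13_main_iff_rebindX_XB13OfRecord` at `φ := θ.toStage5₁₂`, through `toStage5₁₂_pinB13`):
«b9 → b10 → b11 → b12 → b13» with `b13` THE LEAF AT THE GROUP OF RECORD, the in-edges at `θ`'s (residual) carriers `res.Y ∕ res.X ∕ res.Z` (the Stage-12 view keeps them, `rfl`).
[cite: Balaban1988RG2Cluster, Lemmas 1–3 pp.9, 11, 20 (the node at the objects of record)] -/
theorem b13_main_iff_toStage5₁₂_pinB13 (θ : Stage12Params F N) (lam : B12.RunParams → ResidB13 θ.toStage3Params) (w : WorldP) (P : B12.RunParams)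
    (hup : w.up P = upOfRecord₅C F N ((θ.pinB13 F N lam).toStage5₁₂ F N) P) :
    Dag.B13_main (leavesP w P) ↔
      (B9LeafX (θ.res.Y P) → (B10.Thm1PrintedCompact (θ.res.X P).runs10 ∧ B10.Thm2Printed (θ.res.X P).runs10) → B11Leaf (θ.res.Z P) →
        B12Sec2to5.Lemma4Printed (θ.res.X P).F12 (θ.res.X P).c12 → B13LeafOfRecord θ.toStage3Params (lam P)) := by
  rw [Stage12Params.toStage5₁₂_pinB13] at hup
  exact b13_main_iff_rebindX_XB13OfRecord (θ.toStage5₁₂ F N) lam θ.res.X w P hup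

/-- **N10 AT `(w, P)` FROM THE TORUS LEAF TRIPLE AT THE STEP OF RECORD, at the C-binding of the [B13]-pinned Stage-12 view** (`CarriersB13.b13_main_at_rebindX_XB13OfRecord` at
`φ := θ.toStage5₁₂`). [cite: Balaban1988RG2Cluster, Lemma 1 p.9, Lemma 2 p.11, Lemma 3 p.20] -/
theorem b13_main_at_toStage5₁₂_pinB13 (θ : Stage12Params F N) (lam : B12.RunParams → ResidB13 θ.toStage3Params) (w : WorldP) (P : B12.RunParams)
    (hup : w.up P = upOfRecord₅C F N ((θ.pinB13 F N lam).toStage5₁₂ F N) P)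
    (hleaf : B9LeafX (θ.res.Y P) → (B10.Thm1PrintedCompact (θ.res.X P).runs10 ∧ B10.Thm2Printed (θ.res.X P).runs10) → B11Leaf (θ.res.Z P) →
      B12Sec2to5.Lemma4Printed (θ.res.X P).F12 (θ.res.X P).c12 →
        B13.Lemma1Printed (WtOfRecord θ.toStage3Params (lam P)).toStepData (c13OfRecord θ.toStage3Params (lam P)) ∧
          B13.Lemma2Printed (WtOfRecord θ.toStage3Params (lam P)).toStepData (c13OfRecord θ.toStage3Params (lam P)) ∧
            B13.Lemma3Printed (WtOfRecord θ.toStage3Params (lam P)).toStepData (c13OfRecord θ.toStage3Params (lam P))) :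
    Dag.B13_main (leavesP w P) := by
  rw [Stage12Params.toStage5₁₂_pinB13] at hup
  exact b13_main_at_rebindX_XB13OfRecord (θ.toStage5₁₂ F N) lam θ.res.X w P hup hleaf

end Pin12

/-! ## §2. The seven-pin Stage-12 views (full [B8] family ∕ [B8′] sub-family) and their leaves, by name -/

section Views12

variable (F : T4Family) (N : ℕ) [NeZero N]

/-- **The seven-pin Stage-12 view** ([B13] innermost: g32's six-pin view `view₁₂B12B8B10YZW` OF THE [B13]-PINNED parameters, so every earlier face is the earlier modules' face at
`θ.pinB13 lam13` BY NAME). [cite: Balaban1988RG2Cluster, Lemmas 1–3 pp.9–20; Balaban1987RG1, Lemma 4 p.280; Balaban1985RegularSpaces, Thm 2 p.83; Balaban1985UV3, Thm 1 p.257; Balaban1985BackgroundPropagators, Thm 3.1 p.397; Balaban1985Variational, Thm 1 p.279; Balaban1989LargeFieldI, (0.2) p.176 (objects of record)] -/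
def Stage12Params.view₁₂B13B12B8B10YZW (θ : Stage12Params F N) (lam13 : B12.RunParams → ResidB13 θ.toStage3Params) (lam12 : ResidB12 F N θ.τ9.M)
    (lam8 : ResidB8 θ.toStage3Params) (Mstar : ℕ) (ops : OpsY N θ.toStage3Params Mstar) (ζ : ResidZ F N) (lamW : ResidW F N) : Stage5Params F N :=
  (θ.pinB13 F N lam13).view₁₂B12B8B10YZW F N lam12 lam8 Mstar ops ζ lamW

/-- **The seven-pin Stage-12 view with [B8′]** ([B13] innermost, then g32's six-pin view with the sub-family [B8] pin `view₁₂B12B8subB10YZW`).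
[cite: Balaban1988RG2Cluster, Lemmas 1–3 pp.9–20; Balaban1987RG1, Lemma 4 p.280; Balaban1985RegularSpaces, Thm 2 p.83 (objects of record)] -/
def Stage12Params.view₁₂B13B12B8subB10YZW (θ : Stage12Params F N) (lam13 : B12.RunParams → ResidB13 θ.toStage3Params) (lam12 : ResidB12 F N θ.τ9.M)
    (lam8 : ResidB8 θ.toStage3Params) (Mstar : ℕ) (ops : OpsY N θ.toStage3Params Mstar) (ζ : ResidZ F N) (lamW : ResidW F N) : Stage5Params F N :=
  (θ.pinB13 F N lam13).view₁₂B12B8subB10YZW F N lam12 lam8 Mstar ops ζ lamW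

/-- **The `b13` leaf of the S-binding over the seven-pin view IS the leaf at the group of record** (`Iff.rfl`: the [B12] ∕ [B8] ∕ [B10] re-bindings and the Y ∕ Z ∕ W pins keep the
[B13] group). [cite: Balaban1988RG2Cluster, Lemma 1 p.9, Lemma 2 p.11, Lemma 3 p.20 (the leaf at the objects of record)] -/
theorem upOfRecord₅CS_view₁₂B13B12B8B10YZW_b13_iff (θ : Stage12Params F N) (lam13 : B12.RunParams → ResidB13 θ.toStage3Params) (lam12 : ResidB12 F N θ.τ9.M)
    (lam8 : ResidB8 θ.toStage3Params) (Mstar : ℕ) (ops : OpsY N θ.toStage3Params Mstar) (ζ : ResidZ F N) (lamW : ResidW F N) (P : B12.RunParams) :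
    (upOfRecord₅CS F N (θ.view₁₂B13B12B8B10YZW F N lam13 lam12 lam8 Mstar ops ζ lamW) P).b13 ↔ B13LeafOfRecord θ.toStage3Params (lam13 P) := Iff.rfl

/-- … the C-binding's too (`Iff.rfl`). [cite: Balaban1988RG2Cluster, Lemmas 1–3 pp.9–20 (bookkeeping)] -/
theorem upOfRecord₅C_view₁₂B13B12B8B10YZW_b13_iff (θ : Stage12Params F N) (lam13 : B12.RunParams → ResidB13 θ.toStage3Params) (lam12 : ResidB12 F N θ.τ9.M)
    (lam8 : ResidB8 θ.toStage3Params) (Mstar : ℕ) (ops : OpsY N θ.toStage3Params Mstar) (ζ : ResidZ F N) (lamW : ResidW F N) (P : B12.RunParams) :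
    (upOfRecord₅C F N (θ.view₁₂B13B12B8B10YZW F N lam13 lam12 lam8 Mstar ops ζ lamW) P).b13 ↔ B13LeafOfRecord θ.toStage3Params (lam13 P) := Iff.rfl

/-- **The leaves of the S-binding over the seven-pin view, by name**: `b13` (`Iff.rfl`) and the six faces of `Record12Carriers` at `θ.pinB13 lam13`.
[cite: Balaban1988RG2Cluster, Lemmas 1–3 pp.9–20; Balaban1987RG1, Lemma 4 p.280; Balaban1985RegularSpaces, Lemma 1 – Thm 8 pp.79–101; Balaban1989LargeFieldI, Prop. 1 p.194; Balaban1985BackgroundPropagators, Thm 3.1 p.397; Balaban1985UV3, Thm 1 p.257; Balaban1985Variational, Thm 1 p.279] -/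
theorem upOfRecord₅CS_view₁₂B13B12B8B10YZW_leaves (θ : Stage12Params F N) (lam13 : B12.RunParams → ResidB13 θ.toStage3Params) (lam12 : ResidB12 F N θ.τ9.M)
    (lam8 : ResidB8 θ.toStage3Params) (Mstar : ℕ) (ops : OpsY N θ.toStage3Params Mstar) (ζ : ResidZ F N) (lamW : ResidW F N) (P : B12.RunParams) :
    ((upOfRecord₅CS F N (θ.view₁₂B13B12B8B10YZW F N lam13 lam12 lam8 Mstar ops ζ lamW) P).b13 ↔ B13LeafOfRecord θ.toStage3Params (lam13 P)) ∧
    ((upOfRecord₅CS F N (θ.view₁₂B13B12B8B10YZW F N lam13 lam12 lam8 Mstar ops ζ lamW) P).b12 ↔ B12LeafOfRecord₁₂ F N θ lam12 P) ∧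
    ((upOfRecord₅CS F N (θ.view₁₂B13B12B8B10YZW F N lam13 lam12 lam8 Mstar ops ζ lamW) P).b8 ↔ B8LeafOfRecord θ.toStage3Params lam8) ∧
    ((upOfRecord₅CS F N (θ.view₁₂B13B12B8B10YZW F N lam13 lam12 lam8 Mstar ops ζ lamW) P).rBasicStep ↔ B15Leaf (WOfRecord₁₂ F N θ lamW P)) ∧
    ((upOfRecord₅CS F N (θ.view₁₂B13B12B8B10YZW F N lam13 lam12 lam8 Mstar ops ζ lamW) P).b9 ↔ B9LeafX (Y9OfRecord N θ.toStage3Params Mstar ops)) ∧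
    ((upOfRecord₅CS F N (θ.view₁₂B13B12B8B10YZW F N lam13 lam12 lam8 Mstar ops ζ lamW) P).b10 ↔ PrintedUV3V N θ.L) ∧
    ((upOfRecord₅CS F N (θ.view₁₂B13B12B8B10YZW F N lam13 lam12 lam8 Mstar ops ζ lamW) P).b11 ↔ B11Leaf (Z11OfRecord F N ζ)) :=
  ⟨Iff.rfl, upOfRecord₅CS_view₁₂B12B8B10YZW_leaves F N (θ.pinB13 F N lam13) lam12 lam8 Mstar ops ζ lamW P⟩

/-- The `b13` leaf of the S-binding over the seven-pin view with [B8′] IS the leaf at the group of record (`Iff.rfl`). [cite: Balaban1988RG2Cluster, Lemma 1 p.9, Lemma 2 p.11, Lemma 3 p.20 (bookkeeping)] -/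
theorem upOfRecord₅CS_view₁₂B13B12B8subB10YZW_b13_iff (θ : Stage12Params F N) (lam13 : B12.RunParams → ResidB13 θ.toStage3Params) (lam12 : ResidB12 F N θ.τ9.M)
    (lam8 : ResidB8 θ.toStage3Params) (Mstar : ℕ) (ops : OpsY N θ.toStage3Params Mstar) (ζ : ResidZ F N) (lamW : ResidW F N) (P : B12.RunParams) :
    (upOfRecord₅CS F N (θ.view₁₂B13B12B8subB10YZW F N lam13 lam12 lam8 Mstar ops ζ lamW) P).b13 ↔ B13LeafOfRecord θ.toStage3Params (lam13 P) := Iff.rfl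

/-- **The leaves of the S-binding over the seven-pin view with [B8′], by name**: `b13` (`Iff.rfl`) and g32's six at `θ.pinB13 lam13` (`b8 ↔ B8LeafOfRecordSub`).
[cite: Balaban1988RG2Cluster, Lemmas 1–3 pp.9–20; Balaban1987RG1, Lemma 4 p.280; Balaban1985RegularSpaces, Lemma 1 – Thm 8 pp.79–101; Balaban1989LargeFieldI, Prop. 1 p.194; Balaban1985BackgroundPropagators, Thm 3.1 p.397; Balaban1985UV3, Thm 1 p.257; Balaban1985Variational, Thm 1 p.279] -/
theorem upOfRecord₅CS_view₁₂B13B12B8subB10YZW_leaves (θ : Stage12Params F N) (lam13 : B12.RunParams → ResidB13 θ.toStage3Params) (lam12 : ResidB12 F N θ.τ9.M)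
    (lam8 : ResidB8 θ.toStage3Params) (Mstar : ℕ) (ops : OpsY N θ.toStage3Params Mstar) (ζ : ResidZ F N) (lamW : ResidW F N) (P : B12.RunParams) :
    ((upOfRecord₅CS F N (θ.view₁₂B13B12B8subB10YZW F N lam13 lam12 lam8 Mstar ops ζ lamW) P).b13 ↔ B13LeafOfRecord θ.toStage3Params (lam13 P)) ∧
    ((upOfRecord₅CS F N (θ.view₁₂B13B12B8subB10YZW F N lam13 lam12 lam8 Mstar ops ζ lamW) P).b12 ↔ B12LeafOfRecord₁₂ F N θ lam12 P) ∧
    ((upOfRecord₅CS F N (θ.view₁₂B13B12B8subB10YZW F N lam13 lam12 lam8 Mstar ops ζ lamW) P).b8 ↔ B8LeafOfRecordSub θ.toStage3Params lam8) ∧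
    ((upOfRecord₅CS F N (θ.view₁₂B13B12B8subB10YZW F N lam13 lam12 lam8 Mstar ops ζ lamW) P).rBasicStep ↔ B15Leaf (WOfRecord₁₂ F N θ lamW P)) ∧
    ((upOfRecord₅CS F N (θ.view₁₂B13B12B8subB10YZW F N lam13 lam12 lam8 Mstar ops ζ lamW) P).b9 ↔ B9LeafX (Y9OfRecord N θ.toStage3Params Mstar ops)) ∧
    ((upOfRecord₅CS F N (θ.view₁₂B13B12B8subB10YZW F N lam13 lam12 lam8 Mstar ops ζ lamW) P).b10 ↔ PrintedUV3V N θ.L) ∧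
    ((upOfRecord₅CS F N (θ.view₁₂B13B12B8subB10YZW F N lam13 lam12 lam8 Mstar ops ζ lamW) P).b11 ↔ B11Leaf (Z11OfRecord F N ζ)) :=
  ⟨Iff.rfl, upOfRecord₅CS_view₁₂B12B8subB10YZW_leaves F N (θ.pinB13 F N lam13) lam12 lam8 Mstar ops ζ lamW P⟩

end Views12

/-! ## §3. The cumulative Stage-12 record `IsRecordOfRecord₁₂CB10YZWB8B12B13` — all SEVEN groups pinned, full [B8] family; refinement, faces, honesty -/

section Record12B13

variable (F : T4Family) (N : ℕ) [NeZero N]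

/-- **«(D, w) is the record, Stage 12, all SEVEN typed carrier groups [B10] ∕ [B9] ∕ [B11] ∕ [IV] ∕ [B8] ∕ [B12] ∕ [B13] pinned, `b8` surviving»**: g32's
`IsRecordOfRecord₁₂CB10YZWB8B12` VERBATIM with a residual [B13] term layer `lam13` (one per run) added and the upstream block the S-binding at the seven-pin view (residual data
quantified with the record's parameters; no law assumed). [cite: Balaban1988RG2Cluster, Lemmas 1–3 pp.9–20; Balaban1989LargeFieldII, Thm 1 + (0.1) pp.355–356 (objects of record)] -/
def IsRecordOfRecord₁₂CB10YZWB8B12B13 (D : FiniteEpsData F (SU N)) (w : WorldP) : Prop :=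
  ∃ (θ : Stage12Params F N) (h : θ.Provisos₁₂ F N) (lam13 : B12.RunParams → ResidB13 θ.toStage3Params) (lam12 : ResidB12 F N θ.τ9.M) (lam8 : ResidB8 θ.toStage3Params)
    (Mstar : ℕ) (ops : OpsY N θ.toStage3Params Mstar) (ζ : ResidZ F N) (lamW : ResidW F N),
    θ.Admissible F N ∧ D = datumOfRecord₁₂ F N θ h ∧ w.C = D.C ∧ (0 < w.γ ∧ w.γ ≤ θ.γ) ∧ w.L = (θ.L : ℝ) ∧
      ∀ P : B12.RunParams, w.up P = upOfRecord₅CS F N (θ.view₁₂B13B12B8B10YZW F N lam13 lam12 lam8 Mstar ops ζ lamW) P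

/-- Inhabitation is Stage 12's exactly (all seven residual types inhabited; `nonempty_residB13`, `nonempty_residB12`). [cite: Balaban1989LargeFieldII, Thm 1 + (0.1) pp.355–356 (bookkeeping)] -/
theorem exists_world_isRecordOfRecord₁₂CB10YZWB8B12B13 (θ : Stage12Params F N) (h : θ.Provisos₁₂ F N) (hθ : θ.Admissible F N)
    (lam13 : B12.RunParams → ResidB13 θ.toStage3Params) (lam12 : ResidB12 F N θ.τ9.M) (lam8 : ResidB8 θ.toStage3Params) (Mstar : ℕ) (ops : OpsY N θ.toStage3Params Mstar)
    (ζ : ResidZ F N) (lamW : ResidW F N) {γw : ℝ} (hγw : 0 < γw ∧ γw ≤ θ.γ) :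
    ∃ w : WorldP, IsRecordOfRecord₁₂CB10YZWB8B12B13 F N (datumOfRecord₁₂ F N θ h) w ∧ w.γ = γw := by
  obtain ⟨w₀, -, -⟩ := exists_world_isRecordOfRecord₁₂C F N θ h hθ hγw
  exact ⟨{ w₀ with
      C := (datumOfRecord₁₂ F N θ h).C, γ := γw, L := (θ.L : ℝ), one_lt_L := by exact_mod_cast θ.hL.2,
      up := fun P => upOfRecord₅CS F N (θ.view₁₂B13B12B8B10YZW F N lam13 lam12 lam8 Mstar ops ζ lamW) P },
    ⟨θ, h, lam13, lam12, lam8, Mstar, ops, ζ, lamW, hθ, rfl, rfl, hγw, rfl, fun _ => rfl⟩, rfl⟩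

/-- … in particular the predicate is inhabited over every admissible Stage-12 package with provisos (the junk layers of `CarriersB13` §1 ∕ the sibling modules).
[cite: Balaban1989LargeFieldII, Thm 1 + (0.1) pp.355–356 (bookkeeping)] -/
theorem exists_isRecordOfRecord₁₂CB10YZWB8B12B13 (θ : Stage12Params F N) (h : θ.Provisos₁₂ F N) (hθ : θ.Admissible F N) (Mstar : ℕ) (ops : OpsY N θ.toStage3Params Mstar)
    {γw : ℝ} (hγw : 0 < γw ∧ γw ≤ θ.γ) : ∃ w : WorldP, IsRecordOfRecord₁₂CB10YZWB8B12B13 F N (datumOfRecord₁₂ F N θ h) w ∧ w.γ = γw := by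
  obtain ⟨lam13⟩ := nonempty_residB13 θ.toStage3Params
  obtain ⟨lam12⟩ := nonempty_residB12 F N θ.τ9.M
  obtain ⟨lam8⟩ := nonempty_residB8 (θ := θ.toStage3Params)
  obtain ⟨ζ⟩ := nonempty_residZ (F := F) (N := N)
  obtain ⟨lamW⟩ := nonempty_residW (F := F) (N := N)
  exact exists_world_isRecordOfRecord₁₂CB10YZWB8B12B13 F N θ h hθ (fun _ => lam13) lam12 lam8 Mstar ops ζ lamW hγw

/-- **HONESTY AT THE RECORD, ∃-side (dag-ref-B READ-371 A2, kernel)**: over EVERY admissible Stage-12 package with provisos there is a record world of this module whose `b13` leaf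
HOLDS at every run — its [B13] layer has EMPTY spaces (`CarriersB13.exists_residB13_b13LeafOfRecord`), so the printed lemmas hold VACUOUSLY there.  A count of N10 through a
record of this module must therefore DISPLAY the layer and check it non-degenerate. [cite: Balaban1988RG2Cluster, (1.34) p.9 and p.15 (the spaces are non-empty in print)] -/
theorem exists_isRecordOfRecord₁₂CB10YZWB8B12B13_forall_b13 (θ : Stage12Params F N) (h : θ.Provisos₁₂ F N) (hθ : θ.Admissible F N) (Mstar : ℕ)
    (ops : OpsY N θ.toStage3Params Mstar) {γw : ℝ} (hγw : 0 < γw ∧ γw ≤ θ.γ) :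
    ∃ w : WorldP, IsRecordOfRecord₁₂CB10YZWB8B12B13 F N (datumOfRecord₁₂ F N θ h) w ∧ w.γ = γw ∧ ∀ P : B12.RunParams, (leavesP w P).b13 := by
  obtain ⟨lam13, h13⟩ := exists_residB13_b13LeafOfRecord θ.toStage3Params
  obtain ⟨lam12⟩ := nonempty_residB12 F N θ.τ9.M
  obtain ⟨lam8⟩ := nonempty_residB8 (θ := θ.toStage3Params)
  obtain ⟨ζ⟩ := nonempty_residZ (F := F) (N := N)
  obtain ⟨lamW⟩ := nonempty_residW (F := F) (N := N)
  obtain ⟨w₀, -, -⟩ := exists_world_isRecordOfRecord₁₂C F N θ h hθ hγw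
  exact ⟨{ w₀ with
      C := (datumOfRecord₁₂ F N θ h).C, γ := γw, L := (θ.L : ℝ), one_lt_L := by exact_mod_cast θ.hL.2,
      up := fun P => upOfRecord₅CS F N (θ.view₁₂B13B12B8B10YZW F N (fun _ => lam13) lam12 lam8 Mstar ops ζ lamW) P },
    ⟨θ, h, fun _ => lam13, lam12, lam8, Mstar, ops, ζ, lamW, hθ, rfl, rfl, hγw, rfl, fun _ => rfl⟩, rfl, fun _ => h13⟩

/-- **HONESTY AT THE RECORD, ∀-side (R433 species, kernel)**: over EVERY admissible Stage-12 package with provisos there is a record world of this module whose `b13` leaf FAILS at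
every run — its [B13] layer has `GaugeInv := False` (`CarriersB13.exists_residB13_not_b13LeafOfRecord`); so «∀ records of this module, b13» is junk-REFUTABLE: the leaf at a
record is decided by the HIDDEN layer, not by the datum. [cite: Balaban1988RG2Cluster, Lemma 2 p.11 (the gauge-invariance clause)] -/
theorem exists_isRecordOfRecord₁₂CB10YZWB8B12B13_forall_not_b13 (θ : Stage12Params F N) (h : θ.Provisos₁₂ F N) (hθ : θ.Admissible F N) (Mstar : ℕ)
    (ops : OpsY N θ.toStage3Params Mstar) {γw : ℝ} (hγw : 0 < γw ∧ γw ≤ θ.γ) :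
    ∃ w : WorldP, IsRecordOfRecord₁₂CB10YZWB8B12B13 F N (datumOfRecord₁₂ F N θ h) w ∧ w.γ = γw ∧ ∀ P : B12.RunParams, ¬ (leavesP w P).b13 := by
  obtain ⟨lam13, h13⟩ := exists_residB13_not_b13LeafOfRecord θ.toStage3Params
  obtain ⟨lam12⟩ := nonempty_residB12 F N θ.τ9.M
  obtain ⟨lam8⟩ := nonempty_residB8 (θ := θ.toStage3Params)
  obtain ⟨ζ⟩ := nonempty_residZ (F := F) (N := N)
  obtain ⟨lamW⟩ := nonempty_residW (F := F) (N := N)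
  obtain ⟨w₀, -, -⟩ := exists_world_isRecordOfRecord₁₂C F N θ h hθ hγw
  exact ⟨{ w₀ with
      C := (datumOfRecord₁₂ F N θ h).C, γ := γw, L := (θ.L : ℝ), one_lt_L := by exact_mod_cast θ.hL.2,
      up := fun P => upOfRecord₅CS F N (θ.view₁₂B13B12B8B10YZW F N (fun _ => lam13) lam12 lam8 Mstar ops ζ lamW) P },
    ⟨θ, h, fun _ => lam13, lam12, lam8, Mstar, ops, ζ, lamW, hθ, rfl, rfl, hγw, rfl, fun _ => rfl⟩, rfl, fun _ => h13⟩

variable {F N}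
variable {D : FiniteEpsData F (SU N)} {w : WorldP}

/-- **Refinement `IsRecordOfRecord₁₂CB10YZWB8B12B13 → IsRecordOfRecord₁₂CB10YZWB8B12` with THE SAME datum AND THE SAME world** (witness `θ.pinB13 lam13`: provisos transported,
admissibility by the `iff`, datum by `datumOfRecord₁₂_pinB13`, the view definitionally); hence, by g32's refinements, also `→ …B8` and the same-datum `₁₂C` companion.
[cite: Balaban1989LargeFieldII, Thm 1 + (0.1) pp.355–356 (bookkeeping)] -/
theorem isRecordOfRecord₁₂CB10YZWB8B12_of_isRecordOfRecord₁₂CB10YZWB8B12B13 (h : IsRecordOfRecord₁₂CB10YZWB8B12B13 F N D w) :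
    IsRecordOfRecord₁₂CB10YZWB8B12 F N D w := by
  obtain ⟨θ, hP, lam13, lam12, lam8, Mstar, ops, ζ, lamW, hθ, hD, hC, hγ, hL, hup⟩ := h
  refine ⟨θ.pinB13 F N lam13, hP.pinB13 lam13, lam12, lam8, Mstar, ops, ζ, lamW, (Stage12Params.pinB13_admissible_iff F N _ _).2 hθ, ?_, hC, hγ, hL, hup⟩
  rw [datumOfRecord₁₂_pinB13]
  exact hD

/-- … and `→ IsRecordOfRecord₁₂CB10YZWB8` (the two refinements composed). [cite: Balaban1989LargeFieldII, Thm 1 + (0.1) pp.355–356 (bookkeeping)] -/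
theorem isRecordOfRecord₁₂CB10YZWB8_of_isRecordOfRecord₁₂CB10YZWB8B12B13 (h : IsRecordOfRecord₁₂CB10YZWB8B12B13 F N D w) : IsRecordOfRecord₁₂CB10YZWB8 F N D w :=
  isRecordOfRecord₁₂CB10YZWB8_of_isRecordOfRecord₁₂CB10YZWB8B12 (isRecordOfRecord₁₂CB10YZWB8B12_of_isRecordOfRecord₁₂CB10YZWB8B12B13 h)

/-- … and the `₁₂C` record with the SAME datum at the companion world (g31 ∕ g32's companion chain; leaves agree off `b8`). [cite: Balaban1989LargeFieldII, Thm 1 + (0.1) pp.355–356 (bookkeeping)] -/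
theorem exists_isRecordOfRecord₁₂C_of_isRecordOfRecord₁₂CB10YZWB8B12B13 (h : IsRecordOfRecord₁₂CB10YZWB8B12B13 F N D w) :
    ∃ w' : WorldP, IsRecordOfRecord₁₂C F N D w' ∧ w'.C = w.C ∧ w'.γ = w.γ ∧ w'.L = w.L ∧
      (∀ P : B12.RunParams, leavesP w P = { leavesP w' P with b8 := (leavesP w P).b8 }) :=
  exists_isRecordOfRecord₁₂C_of_isRecordOfRecord₁₂CB10YZWB8B12 (isRecordOfRecord₁₂CB10YZWB8B12_of_isRecordOfRecord₁₂CB10YZWB8B12B13 h)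

/-- The construction-side in-edges `b4`–`b7` at a record of this module (`Record12CarriersRecords`', through the refinements). [cite: Balaban1989LargeFieldII, Thm 1 p.355 (bookkeeping)] -/
theorem b4_b5_b6_b7_of_isRecordOfRecord₁₂CB10YZWB8B12B13 (h : IsRecordOfRecord₁₂CB10YZWB8B12B13 F N D w) (P : B12.RunParams) :
    (leavesP w P).b4 ∧ (leavesP w P).b5 ∧ (leavesP w P).b6 ∧ (leavesP w P).b7 :=
  b4_b5_b6_b7_of_isRecordOfRecord₁₂CB10YZWB8 (isRecordOfRecord₁₂CB10YZWB8_of_isRecordOfRecord₁₂CB10YZWB8B12B13 h) P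

/-- RE-BINDING a `₁₂C` record's world by the S-binding at the seven-pin view gives a record of this module with the SAME datum. [cite: Balaban1989LargeFieldII, Thm 1 p.355 (bookkeeping)] -/
theorem isRecordOfRecord₁₂CB10YZWB8B12B13_rebind_of_isRecordOfRecord₁₂C (h : IsRecordOfRecord₁₂C F N D w) :
    ∃ (θ : Stage12Params F N) (_ : θ.Provisos₁₂ F N), θ.Admissible F N ∧ (∀ P, w.up P = upOfRecord₅C F N (θ.toStage5₁₂ F N) P) ∧
      ∀ (lam13 : B12.RunParams → ResidB13 θ.toStage3Params) (lam12 : ResidB12 F N θ.τ9.M) (lam8 : ResidB8 θ.toStage3Params) (Mstar : ℕ)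
        (ops : OpsY N θ.toStage3Params Mstar) (ζ : ResidZ F N) (lamW : ResidW F N),
        IsRecordOfRecord₁₂CB10YZWB8B12B13 F N D { w with up := fun P => upOfRecord₅CS F N (θ.view₁₂B13B12B8B10YZW F N lam13 lam12 lam8 Mstar ops ζ lamW) P } := by
  obtain ⟨θ, hP, hθ, hD, hC, hγ, hL, hup⟩ := h
  exact ⟨θ, hP, hθ, hup, fun lam13 lam12 lam8 Mstar ops ζ lamW => ⟨θ, hP, lam13, lam12, lam8, Mstar, ops, ζ, lamW, hθ, hD, hC, hγ, hL, fun _ => rfl⟩⟩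

/-- **THE SEVEN PINNED LEAVES AT A RECORD OF THIS MODULE, for ONE parameter package**. [cite: Balaban1988RG2Cluster, Lemmas 1–3 pp.9–20; Balaban1987RG1, Lemma 4 p.280; Balaban1985RegularSpaces, Lemma 1 – Thm 8 pp.79–101; Balaban1989LargeFieldI, Prop. 1 p.194; Balaban1985BackgroundPropagators, Thm 3.1 p.397; Balaban1985UV3, Thm 1 p.257; Balaban1985Variational, Thm 1 p.279] -/
theorem leaves_iff_of_isRecordOfRecord₁₂CB10YZWB8B12B13 (h : IsRecordOfRecord₁₂CB10YZWB8B12B13 F N D w) :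
    ∃ (θ : Stage12Params F N) (lam13 : B12.RunParams → ResidB13 θ.toStage3Params) (lam12 : ResidB12 F N θ.τ9.M) (lam8 : ResidB8 θ.toStage3Params) (Mstar : ℕ)
      (ops : OpsY N θ.toStage3Params Mstar) (ζ : ResidZ F N) (lamW : ResidW F N), θ.Admissible F N ∧ w.L = (θ.L : ℝ) ∧ ∀ P : B12.RunParams,
        ((leavesP w P).b13 ↔ B13LeafOfRecord θ.toStage3Params (lam13 P)) ∧ ((leavesP w P).b12 ↔ B12LeafOfRecord₁₂ F N θ lam12 P) ∧
        ((leavesP w P).b8 ↔ B8LeafOfRecord θ.toStage3Params lam8) ∧ ((leavesP w P).rBasicStep ↔ B15Leaf (WOfRecord₁₂ F N θ lamW P)) ∧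
        ((leavesP w P).b9 ↔ B9LeafX (Y9OfRecord N θ.toStage3Params Mstar ops)) ∧ ((leavesP w P).b10 ↔ PrintedUV3V N θ.L) ∧
        ((leavesP w P).b11 ↔ B11Leaf (Z11OfRecord F N ζ)) := by
  obtain ⟨θ, -, lam13, lam12, lam8, Mstar, ops, ζ, lamW, hθ, -, -, -, hL, hup⟩ := h
  refine ⟨θ, lam13, lam12, lam8, Mstar, ops, ζ, lamW, hθ, hL, fun P => ?_⟩
  have hl := upOfRecord₅CS_view₁₂B13B12B8B10YZW_leaves F N θ lam13 lam12 lam8 Mstar ops ζ lamW P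
  refine ⟨?_, ?_, ?_, ?_, ?_, ?_, ?_⟩
  · show (w.up P).b13 ↔ _
    rw [hup P]; exact hl.1
  · show (w.up P).b12 ↔ _
    rw [hup P]; exact hl.2.1
  · show (w.up P).b8 ↔ _
    rw [hup P]; exact hl.2.2.1
  · show (w.up P).rBasicStep ↔ _
    rw [hup P]; exact hl.2.2.2.1
  · show (w.up P).b9 ↔ _
    rw [hup P]; exact hl.2.2.2.2.1
  · show (w.up P).b10 ↔ _
    rw [hup P]; exact hl.2.2.2.2.2.1
  · show (w.up P).b11 ↔ _
    rw [hup P]; exact hl.2.2.2.2.2.2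

/-- **THE OWN LEAF OF N10 AT A RECORD OF THIS MODULE**: `b13` IS the printed triple at the group of record, for one parameter package. [cite: Balaban1988RG2Cluster, Lemma 1 p.9, Lemma 2 p.11, Lemma 3 p.20 (the leaf at the objects of record)] -/
theorem leaf_b13_iff_of_isRecordOfRecord₁₂CB10YZWB8B12B13 (h : IsRecordOfRecord₁₂CB10YZWB8B12B13 F N D w) :
    ∃ (θ : Stage12Params F N) (lam13 : B12.RunParams → ResidB13 θ.toStage3Params), θ.Admissible F N ∧ w.L = (θ.L : ℝ) ∧
      ∀ P : B12.RunParams, (leavesP w P).b13 ↔ B13LeafOfRecord θ.toStage3Params (lam13 P) := by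
  obtain ⟨θ, lam13, _, _, _, _, _, _, hθ, hL, hl⟩ := leaves_iff_of_isRecordOfRecord₁₂CB10YZWB8B12B13 h
  exact ⟨θ, lam13, hθ, hL, fun P => (hl P).1⟩

/-- **N10 AT A RECORD OF THIS MODULE**: «b9 → b10 → b11 → b12 → b13» with `b13` THE LEAF AT THE GROUP OF RECORD (the in-edges as the world's leaves; their pinned readings are
`leaves_iff_of_…` ∕ the next theorem). [cite: Balaban1988RG2Cluster, Lemmas 1–3 pp.9, 11, 20 (the node at the objects of record)] -/
theorem b13_main_iff_of_isRecordOfRecord₁₂CB10YZWB8B12B13 (h : IsRecordOfRecord₁₂CB10YZWB8B12B13 F N D w) :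
    ∃ (θ : Stage12Params F N) (lam13 : B12.RunParams → ResidB13 θ.toStage3Params), θ.Admissible F N ∧ w.L = (θ.L : ℝ) ∧ ∀ P : B12.RunParams,
      (Dag.B13_main (leavesP w P) ↔
        ((leavesP w P).b9 → (leavesP w P).b10 → (leavesP w P).b11 → (leavesP w P).b12 → B13LeafOfRecord θ.toStage3Params (lam13 P))) := by
  obtain ⟨θ, lam13, hθ, hL, hl⟩ := leaf_b13_iff_of_isRecordOfRecord₁₂CB10YZWB8B12B13 h
  refine ⟨θ, lam13, hθ, hL, fun P => ?_⟩
  have h13 := hl P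
  exact ⟨fun hN h9 h10 h11 h12 => h13.1 (hN h9 h10 h11 h12), fun hN h9 h10 h11 h12 => h13.2 (hN h9 h10 h11 h12)⟩

/-- **N10 AT THE BUNDLES OF RECORD, for ONE parameter package** (every in-edge in its pinned reading).
[cite: Balaban1988RG2Cluster, Lemmas 1–3 pp.9, 11, 20; Balaban1985BackgroundPropagators, Thm 3.1 p.397; Balaban1985UV3, Thm 1 p.257; Balaban1985Variational, Thm 1 p.279; Balaban1987RG1, Lemma 4 p.280 (the node at the objects of record)] -/
theorem b13_main_iff_bundles_of_isRecordOfRecord₁₂CB10YZWB8B12B13 (h : IsRecordOfRecord₁₂CB10YZWB8B12B13 F N D w) :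
    ∃ (θ : Stage12Params F N) (lam13 : B12.RunParams → ResidB13 θ.toStage3Params) (lam12 : ResidB12 F N θ.τ9.M) (Mstar : ℕ) (ops : OpsY N θ.toStage3Params Mstar)
      (ζ : ResidZ F N), θ.Admissible F N ∧ w.L = (θ.L : ℝ) ∧ ∀ P : B12.RunParams,
        (Dag.B13_main (leavesP w P) ↔
          (B9LeafX (Y9OfRecord N θ.toStage3Params Mstar ops) → PrintedUV3V N θ.L → B11Leaf (Z11OfRecord F N ζ) → B12LeafOfRecord₁₂ F N θ lam12 P →
            B13LeafOfRecord θ.toStage3Params (lam13 P))) := by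
  obtain ⟨θ, lam13, lam12, lam8, Mstar, ops, ζ, lamW, hθ, hL, hl⟩ := leaves_iff_of_isRecordOfRecord₁₂CB10YZWB8B12B13 h
  refine ⟨θ, lam13, lam12, Mstar, ops, ζ, hθ, hL, fun P => ?_⟩
  obtain ⟨h13, h12, -, -, h9, h10, h11⟩ := hl P
  rw [B13NodeKnitRecord5C.b13_main_iff_up]
  show ((leavesP w P).b9 → (leavesP w P).b10 → (leavesP w P).b11 → (leavesP w P).b12 → (leavesP w P).b13) ↔ _
  rw [h9, h10, h11, h12, h13]

/-- **N10 «SLOTS» FORM at a record of this module** (a closer supplies the leaf at the group of record from the in-edges at every presenting parameter package, over the HIDDEN residual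
layers — honest; e.g. `CarriersB13.b13_main_at_rebindX_XB13OfRecord` ∕ `B13NodeTorusTermwise.b13Leaf_twoTorus_termwise` at `WtOfRecord`). [cite: Balaban1988RG2Cluster, Lemmas 1–3 pp.9, 11, 20 (the node's shape, bookkeeping)] -/
theorem b13_main_of_isRecordOfRecord₁₂CB10YZWB8B12B13_of_slots (h : IsRecordOfRecord₁₂CB10YZWB8B12B13 F N D w)
    (hB : ∀ (θ : Stage12Params F N) (hP : θ.Provisos₁₂ F N) (lam13 : B12.RunParams → ResidB13 θ.toStage3Params) (lam12 : ResidB12 F N θ.τ9.M) (lam8 : ResidB8 θ.toStage3Params)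
      (Mstar : ℕ) (ops : OpsY N θ.toStage3Params Mstar) (ζ : ResidZ F N) (lamW : ResidW F N), θ.Admissible F N → D = datumOfRecord₁₂ F N θ hP →
        (∀ P, w.up P = upOfRecord₅CS F N (θ.view₁₂B13B12B8B10YZW F N lam13 lam12 lam8 Mstar ops ζ lamW) P) →
          ∀ P, B9LeafX (Y9OfRecord N θ.toStage3Params Mstar ops) → PrintedUV3V N θ.L → B11Leaf (Z11OfRecord F N ζ) → B12LeafOfRecord₁₂ F N θ lam12 P →
            B13LeafOfRecord θ.toStage3Params (lam13 P))
    (P : B12.RunParams) : Dag.B13_main (leavesP w P) := by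
  obtain ⟨θ, hP, lam13, lam12, lam8, Mstar, ops, ζ, lamW, hθ, hD, -, -, -, hup⟩ := h
  have hl := upOfRecord₅CS_view₁₂B13B12B8B10YZW_leaves F N θ lam13 lam12 lam8 Mstar ops ζ lamW P
  rw [B13NodeKnitRecord5C.b13_main_iff_up, hup P]
  intro h9 h10 h11 h12
  exact hl.1.2 (hB θ hP lam13 lam12 lam8 Mstar ops ζ lamW hθ hD hup P (hl.2.2.2.2.1.1 h9) (hl.2.2.2.2.2.1.1 h10) (hl.2.2.2.2.2.2.1 h11) (hl.2.1.1 h12))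

end Record12B13

/-! ## §4. The [B8′] twin `IsRecordOfRecord₁₂CB10YZWB8subB12B13` — all SEVEN groups pinned, [B8] over the sub-index of record; refinement, faces, OLD ⇒ NEW -/

section Record12B8subB13

variable (F : T4Family) (N : ℕ) [NeZero N]

/-- **«(D, w) is the record, Stage 12, all SEVEN typed carrier groups pinned, [B8] over the SUB-INDEX of record, `b8` surviving»**: g32's `IsRecordOfRecord₁₂CB10YZWB8subB12` VERBATIM
with the residual [B13] term layer `lam13` added, the upstream block the S-binding at the seven-pin view with [B8′] (residual layers quantified with the record's parameters; no law
assumed beyond the sub-index's). [cite: Balaban1988RG2Cluster, Lemmas 1–3 pp.9–20; Balaban1985RegularSpaces, Lemma 1 – Thm 8 pp.79–101; Balaban1989LargeFieldII, Thm 1 + (0.1) pp.355–356 (objects of record)] -/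
def IsRecordOfRecord₁₂CB10YZWB8subB12B13 (D : FiniteEpsData F (SU N)) (w : WorldP) : Prop :=
  ∃ (θ : Stage12Params F N) (h : θ.Provisos₁₂ F N) (lam13 : B12.RunParams → ResidB13 θ.toStage3Params) (lam12 : ResidB12 F N θ.τ9.M) (lam8 : ResidB8 θ.toStage3Params)
    (Mstar : ℕ) (ops : OpsY N θ.toStage3Params Mstar) (ζ : ResidZ F N) (lamW : ResidW F N),
    θ.Admissible F N ∧ D = datumOfRecord₁₂ F N θ h ∧ w.C = D.C ∧ (0 < w.γ ∧ w.γ ≤ θ.γ) ∧ w.L = (θ.L : ℝ) ∧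
      ∀ P : B12.RunParams, w.up P = upOfRecord₅CS F N (θ.view₁₂B13B12B8subB10YZW F N lam13 lam12 lam8 Mstar ops ζ lamW) P

/-- Inhabitation is Stage 12's exactly (all seven residual types inhabited). [cite: Balaban1989LargeFieldII, Thm 1 + (0.1) pp.355–356 (bookkeeping)] -/
theorem exists_world_isRecordOfRecord₁₂CB10YZWB8subB12B13 (θ : Stage12Params F N) (h : θ.Provisos₁₂ F N) (hθ : θ.Admissible F N)
    (lam13 : B12.RunParams → ResidB13 θ.toStage3Params) (lam12 : ResidB12 F N θ.τ9.M) (lam8 : ResidB8 θ.toStage3Params) (Mstar : ℕ) (ops : OpsY N θ.toStage3Params Mstar)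
    (ζ : ResidZ F N) (lamW : ResidW F N) {γw : ℝ} (hγw : 0 < γw ∧ γw ≤ θ.γ) :
    ∃ w : WorldP, IsRecordOfRecord₁₂CB10YZWB8subB12B13 F N (datumOfRecord₁₂ F N θ h) w ∧ w.γ = γw := by
  obtain ⟨w₀, -, -⟩ := exists_world_isRecordOfRecord₁₂C F N θ h hθ hγw
  exact ⟨{ w₀ with
      C := (datumOfRecord₁₂ F N θ h).C, γ := γw, L := (θ.L : ℝ), one_lt_L := by exact_mod_cast θ.hL.2,
      up := fun P => upOfRecord₅CS F N (θ.view₁₂B13B12B8subB10YZW F N lam13 lam12 lam8 Mstar ops ζ lamW) P },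
    ⟨θ, h, lam13, lam12, lam8, Mstar, ops, ζ, lamW, hθ, rfl, rfl, hγw, rfl, fun _ => rfl⟩, rfl⟩

/-- … in particular the predicate is inhabited over every admissible Stage-12 package with provisos. [cite: Balaban1989LargeFieldII, Thm 1 + (0.1) pp.355–356 (bookkeeping)] -/
theorem exists_isRecordOfRecord₁₂CB10YZWB8subB12B13 (θ : Stage12Params F N) (h : θ.Provisos₁₂ F N) (hθ : θ.Admissible F N) (Mstar : ℕ) (ops : OpsY N θ.toStage3Params Mstar)
    {γw : ℝ} (hγw : 0 < γw ∧ γw ≤ θ.γ) : ∃ w : WorldP, IsRecordOfRecord₁₂CB10YZWB8subB12B13 F N (datumOfRecord₁₂ F N θ h) w ∧ w.γ = γw := by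
  obtain ⟨lam13⟩ := nonempty_residB13 θ.toStage3Params
  obtain ⟨lam12⟩ := nonempty_residB12 F N θ.τ9.M
  obtain ⟨lam8⟩ := nonempty_residB8 (θ := θ.toStage3Params)
  obtain ⟨ζ⟩ := nonempty_residZ (F := F) (N := N)
  obtain ⟨lamW⟩ := nonempty_residW (F := F) (N := N)
  exact exists_world_isRecordOfRecord₁₂CB10YZWB8subB12B13 F N θ h hθ (fun _ => lam13) lam12 lam8 Mstar ops ζ lamW hγw

variable {F N}
variable {D : FiniteEpsData F (SU N)} {w : WorldP}

/-- **Refinement `IsRecordOfRecord₁₂CB10YZWB8subB12B13 → IsRecordOfRecord₁₂CB10YZWB8subB12` with THE SAME datum AND THE SAME world** (witness `θ.pinB13 lam13`).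
[cite: Balaban1989LargeFieldII, Thm 1 + (0.1) pp.355–356 (bookkeeping)] -/
theorem isRecordOfRecord₁₂CB10YZWB8subB12_of_isRecordOfRecord₁₂CB10YZWB8subB12B13 (h : IsRecordOfRecord₁₂CB10YZWB8subB12B13 F N D w) :
    IsRecordOfRecord₁₂CB10YZWB8subB12 F N D w := by
  obtain ⟨θ, hP, lam13, lam12, lam8, Mstar, ops, ζ, lamW, hθ, hD, hC, hγ, hL, hup⟩ := h
  refine ⟨θ.pinB13 F N lam13, hP.pinB13 lam13, lam12, lam8, Mstar, ops, ζ, lamW, (Stage12Params.pinB13_admissible_iff F N _ _).2 hθ, ?_, hC, hγ, hL, hup⟩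
  rw [datumOfRecord₁₂_pinB13]
  exact hD

/-- … and the `₁₂C` record with the SAME datum at the companion world (g32's companion chain; leaves agree off `b8`). [cite: Balaban1989LargeFieldII, Thm 1 + (0.1) pp.355–356 (bookkeeping)] -/
theorem exists_isRecordOfRecord₁₂C_of_isRecordOfRecord₁₂CB10YZWB8subB12B13 (h : IsRecordOfRecord₁₂CB10YZWB8subB12B13 F N D w) :
    ∃ w' : WorldP, IsRecordOfRecord₁₂C F N D w' ∧ w'.C = w.C ∧ w'.γ = w.γ ∧ w'.L = w.L ∧
      (∀ P : B12.RunParams, leavesP w P = { leavesP w' P with b8 := (leavesP w P).b8 }) :=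
  exists_isRecordOfRecord₁₂C_of_isRecordOfRecord₁₂CB10YZWB8subB12 (isRecordOfRecord₁₂CB10YZWB8subB12_of_isRecordOfRecord₁₂CB10YZWB8subB12B13 h)

/-- The in-edges `b4 b5 b6 b7` are THEOREMS at a record of this module (g32's, through the refinement). [cite: Balaban1989LargeFieldII, Thm 1 p.355 (bookkeeping)] -/
theorem b4_b5_b6_b7_of_isRecordOfRecord₁₂CB10YZWB8subB12B13 (h : IsRecordOfRecord₁₂CB10YZWB8subB12B13 F N D w) (P : B12.RunParams) :
    (leavesP w P).b4 ∧ (leavesP w P).b5 ∧ (leavesP w P).b6 ∧ (leavesP w P).b7 :=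
  b4_b5_b6_b7_of_isRecordOfRecord₁₂CB10YZWB8subB12 (isRecordOfRecord₁₂CB10YZWB8subB12_of_isRecordOfRecord₁₂CB10YZWB8subB12B13 h) P

/-- RE-BINDING a `₁₂C` record's world by the S-binding at the seven-pin view with [B8′] gives a record of this module with the SAME datum. [cite: Balaban1989LargeFieldII, Thm 1 p.355 (bookkeeping)] -/
theorem isRecordOfRecord₁₂CB10YZWB8subB12B13_rebind_of_isRecordOfRecord₁₂C (h : IsRecordOfRecord₁₂C F N D w) :
    ∃ (θ : Stage12Params F N) (_ : θ.Provisos₁₂ F N), θ.Admissible F N ∧ (∀ P, w.up P = upOfRecord₅C F N (θ.toStage5₁₂ F N) P) ∧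
      ∀ (lam13 : B12.RunParams → ResidB13 θ.toStage3Params) (lam12 : ResidB12 F N θ.τ9.M) (lam8 : ResidB8 θ.toStage3Params) (Mstar : ℕ)
        (ops : OpsY N θ.toStage3Params Mstar) (ζ : ResidZ F N) (lamW : ResidW F N),
        IsRecordOfRecord₁₂CB10YZWB8subB12B13 F N D { w with up := fun P => upOfRecord₅CS F N (θ.view₁₂B13B12B8subB10YZW F N lam13 lam12 lam8 Mstar ops ζ lamW) P } := by
  obtain ⟨θ, hP, hθ, hD, hC, hγ, hL, hup⟩ := h
  exact ⟨θ, hP, hθ, hup, fun lam13 lam12 lam8 Mstar ops ζ lamW => ⟨θ, hP, lam13, lam12, lam8, Mstar, ops, ζ, lamW, hθ, hD, hC, hγ, hL, fun _ => rfl⟩⟩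

/-- **THE SEVEN PINNED LEAVES AT A RECORD OF THIS MODULE (sub-family [B8]), for ONE parameter package**. [cite: Balaban1988RG2Cluster, Lemmas 1–3 pp.9–20; Balaban1987RG1, Lemma 4 p.280; Balaban1985RegularSpaces, Lemma 1 – Thm 8 pp.79–101; Balaban1989LargeFieldI, Prop. 1 p.194; Balaban1985BackgroundPropagators, Thm 3.1 p.397; Balaban1985UV3, Thm 1 p.257; Balaban1985Variational, Thm 1 p.279] -/
theorem leaves_iff_of_isRecordOfRecord₁₂CB10YZWB8subB12B13 (h : IsRecordOfRecord₁₂CB10YZWB8subB12B13 F N D w) :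
    ∃ (θ : Stage12Params F N) (lam13 : B12.RunParams → ResidB13 θ.toStage3Params) (lam12 : ResidB12 F N θ.τ9.M) (lam8 : ResidB8 θ.toStage3Params) (Mstar : ℕ)
      (ops : OpsY N θ.toStage3Params Mstar) (ζ : ResidZ F N) (lamW : ResidW F N), θ.Admissible F N ∧ w.L = (θ.L : ℝ) ∧ ∀ P : B12.RunParams,
        ((leavesP w P).b13 ↔ B13LeafOfRecord θ.toStage3Params (lam13 P)) ∧ ((leavesP w P).b12 ↔ B12LeafOfRecord₁₂ F N θ lam12 P) ∧
        ((leavesP w P).b8 ↔ B8LeafOfRecordSub θ.toStage3Params lam8) ∧ ((leavesP w P).rBasicStep ↔ B15Leaf (WOfRecord₁₂ F N θ lamW P)) ∧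
        ((leavesP w P).b9 ↔ B9LeafX (Y9OfRecord N θ.toStage3Params Mstar ops)) ∧ ((leavesP w P).b10 ↔ PrintedUV3V N θ.L) ∧
        ((leavesP w P).b11 ↔ B11Leaf (Z11OfRecord F N ζ)) := by
  obtain ⟨θ, -, lam13, lam12, lam8, Mstar, ops, ζ, lamW, hθ, -, -, -, hL, hup⟩ := h
  refine ⟨θ, lam13, lam12, lam8, Mstar, ops, ζ, lamW, hθ, hL, fun P => ?_⟩
  have hl := upOfRecord₅CS_view₁₂B13B12B8subB10YZW_leaves F N θ lam13 lam12 lam8 Mstar ops ζ lamW P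
  refine ⟨?_, ?_, ?_, ?_, ?_, ?_, ?_⟩
  · show (w.up P).b13 ↔ _
    rw [hup P]; exact hl.1
  · show (w.up P).b12 ↔ _
    rw [hup P]; exact hl.2.1
  · show (w.up P).b8 ↔ _
    rw [hup P]; exact hl.2.2.1
  · show (w.up P).rBasicStep ↔ _
    rw [hup P]; exact hl.2.2.2.1
  · show (w.up P).b9 ↔ _
    rw [hup P]; exact hl.2.2.2.2.1
  · show (w.up P).b10 ↔ _
    rw [hup P]; exact hl.2.2.2.2.2.1
  · show (w.up P).b11 ↔ _
    rw [hup P]; exact hl.2.2.2.2.2.2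

/-- **THE OWN LEAF OF N10 AT A RECORD OF THIS MODULE (sub-family [B8])**, for one parameter package. [cite: Balaban1988RG2Cluster, Lemma 1 p.9, Lemma 2 p.11, Lemma 3 p.20 (the leaf at the objects of record)] -/
theorem leaf_b13_iff_of_isRecordOfRecord₁₂CB10YZWB8subB12B13 (h : IsRecordOfRecord₁₂CB10YZWB8subB12B13 F N D w) :
    ∃ (θ : Stage12Params F N) (lam13 : B12.RunParams → ResidB13 θ.toStage3Params), θ.Admissible F N ∧ w.L = (θ.L : ℝ) ∧
      ∀ P : B12.RunParams, (leavesP w P).b13 ↔ B13LeafOfRecord θ.toStage3Params (lam13 P) := by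
  obtain ⟨θ, lam13, _, _, _, _, _, _, hθ, hL, hl⟩ := leaves_iff_of_isRecordOfRecord₁₂CB10YZWB8subB12B13 h
  exact ⟨θ, lam13, hθ, hL, fun P => (hl P).1⟩

/-- **N10 AT THE BUNDLES OF RECORD (sub-family [B8]), for ONE parameter package** (every in-edge in its pinned reading; N10 does not read `b8`).
[cite: Balaban1988RG2Cluster, Lemmas 1–3 pp.9, 11, 20; Balaban1985BackgroundPropagators, Thm 3.1 p.397; Balaban1985UV3, Thm 1 p.257; Balaban1985Variational, Thm 1 p.279; Balaban1987RG1, Lemma 4 p.280 (the node at the objects of record)] -/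
theorem b13_main_iff_bundles_of_isRecordOfRecord₁₂CB10YZWB8subB12B13 (h : IsRecordOfRecord₁₂CB10YZWB8subB12B13 F N D w) :
    ∃ (θ : Stage12Params F N) (lam13 : B12.RunParams → ResidB13 θ.toStage3Params) (lam12 : ResidB12 F N θ.τ9.M) (Mstar : ℕ) (ops : OpsY N θ.toStage3Params Mstar)
      (ζ : ResidZ F N), θ.Admissible F N ∧ w.L = (θ.L : ℝ) ∧ ∀ P : B12.RunParams,
        (Dag.B13_main (leavesP w P) ↔
          (B9LeafX (Y9OfRecord N θ.toStage3Params Mstar ops) → PrintedUV3V N θ.L → B11Leaf (Z11OfRecord F N ζ) → B12LeafOfRecord₁₂ F N θ lam12 P →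
            B13LeafOfRecord θ.toStage3Params (lam13 P))) := by
  obtain ⟨θ, lam13, lam12, lam8, Mstar, ops, ζ, lamW, hθ, hL, hl⟩ := leaves_iff_of_isRecordOfRecord₁₂CB10YZWB8subB12B13 h
  refine ⟨θ, lam13, lam12, Mstar, ops, ζ, hθ, hL, fun P => ?_⟩
  obtain ⟨h13, h12, -, -, h9, h10, h11⟩ := hl P
  rw [B13NodeKnitRecord5C.b13_main_iff_up]
  show ((leavesP w P).b9 → (leavesP w P).b10 → (leavesP w P).b11 → (leavesP w P).b12 → (leavesP w P).b13) ↔ _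
  rw [h9, h10, h11, h12, h13]

/-- **N10 «SLOTS» FORM at a record of this module (sub-family [B8])**. [cite: Balaban1988RG2Cluster, Lemmas 1–3 pp.9, 11, 20 (the node's shape, bookkeeping)] -/
theorem b13_main_of_isRecordOfRecord₁₂CB10YZWB8subB12B13_of_slots (h : IsRecordOfRecord₁₂CB10YZWB8subB12B13 F N D w)
    (hB : ∀ (θ : Stage12Params F N) (hP : θ.Provisos₁₂ F N) (lam13 : B12.RunParams → ResidB13 θ.toStage3Params) (lam12 : ResidB12 F N θ.τ9.M) (lam8 : ResidB8 θ.toStage3Params)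
      (Mstar : ℕ) (ops : OpsY N θ.toStage3Params Mstar) (ζ : ResidZ F N) (lamW : ResidW F N), θ.Admissible F N → D = datumOfRecord₁₂ F N θ hP →
        (∀ P, w.up P = upOfRecord₅CS F N (θ.view₁₂B13B12B8subB10YZW F N lam13 lam12 lam8 Mstar ops ζ lamW) P) →
          ∀ P, B9LeafX (Y9OfRecord N θ.toStage3Params Mstar ops) → PrintedUV3V N θ.L → B11Leaf (Z11OfRecord F N ζ) → B12LeafOfRecord₁₂ F N θ lam12 P →
            B13LeafOfRecord θ.toStage3Params (lam13 P))
    (P : B12.RunParams) : Dag.B13_main (leavesP w P) := by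
  obtain ⟨θ, hP, lam13, lam12, lam8, Mstar, ops, ζ, lamW, hθ, hD, -, -, -, hup⟩ := h
  have hl := upOfRecord₅CS_view₁₂B13B12B8subB10YZW_leaves F N θ lam13 lam12 lam8 Mstar ops ζ lamW P
  rw [B13NodeKnitRecord5C.b13_main_iff_up, hup P]
  intro h9 h10 h11 h12
  exact hl.1.2 (hB θ hP lam13 lam12 lam8 Mstar ops ζ lamW hθ hD hup P (hl.2.2.2.2.1.1 h9) (hl.2.2.2.2.2.1.1 h10) (hl.2.2.2.2.2.2.1 h11) (hl.2.1.1 h12))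

/-- **OLD ⇒ NEW AT THE RECORD LEVEL**: a full-family record of §3 gives the sub-family record WITH THE SAME DATUM at the re-keyed world — same `C`, window, `L`; the leaves `b13`,
`b12`, `rBasicStep`, `b9`, `b10`, `b11`, `b4`–`b7`, `rOperation` are EQUAL and the new `b8` is IMPLIED by the old one (`CarriersB8Sub.b8LeafOfRecordSub_of_b8LeafOfRecord`).
[cite: Balaban1985RegularSpaces, Lemma 1 – Thm 8 pp.79–101 (restriction of the family index); Balaban1989LargeFieldII, Thm 1 p.355 (bookkeeping)] -/
theorem exists_isRecordOfRecord₁₂CB10YZWB8subB12B13_of_isRecordOfRecord₁₂CB10YZWB8B12B13 (h : IsRecordOfRecord₁₂CB10YZWB8B12B13 F N D w) :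
    ∃ w' : WorldP, IsRecordOfRecord₁₂CB10YZWB8subB12B13 F N D w' ∧ w'.C = w.C ∧ w'.γ = w.γ ∧ w'.L = w.L ∧
      (∀ P : B12.RunParams, leavesP w' P = { leavesP w P with b8 := (leavesP w' P).b8 }) ∧
      ∀ P : B12.RunParams, (leavesP w P).b8 → (leavesP w' P).b8 := by
  obtain ⟨θ, hP, lam13, lam12, lam8, Mstar, ops, ζ, lamW, hθ, hD, hC, hγ, hL, hup⟩ := h
  refine ⟨{ w with up := fun P => upOfRecord₅CS F N (θ.view₁₂B13B12B8subB10YZW F N lam13 lam12 lam8 Mstar ops ζ lamW) P },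
    ⟨θ, hP, lam13, lam12, lam8, Mstar, ops, ζ, lamW, hθ, hD, hC, hγ, hL, fun _ => rfl⟩, rfl, rfl, rfl, fun P => ?_, fun P h8 => ?_⟩
  · have hup' : ∀ P, upOfRecord₅CS F N (θ.view₁₂B13B12B8subB10YZW F N lam13 lam12 lam8 Mstar ops ζ lamW) P =
        (w.up P).withB8 (upOfRecord₅CS F N (θ.view₁₂B13B12B8subB10YZW F N lam13 lam12 lam8 Mstar ops ζ lamW) P).b8 := fun P => by
      rw [hup P]; rfl
    exact leavesP_eq_of_up_withB8 (w := { w with up := fun P => upOfRecord₅CS F N (θ.view₁₂B13B12B8subB10YZW F N lam13 lam12 lam8 Mstar ops ζ lamW) P })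
      (u := w.up) hup' P
  · have h8' : B8LeafOfRecord θ.toStage3Params lam8 := by
      have h8w : (w.up P).b8 := h8
      rw [hup P] at h8w
      exact (upOfRecord₅CS_view₁₂B13B12B8B10YZW_leaves F N θ lam13 lam12 lam8 Mstar ops ζ lamW P).2.2.1.1 h8w
    show (upOfRecord₅CS F N (θ.view₁₂B13B12B8subB10YZW F N lam13 lam12 lam8 Mstar ops ζ lamW) P).b8
    exact (upOfRecord₅CS_view₁₂B13B12B8subB10YZW_leaves F N θ lam13 lam12 lam8 Mstar ops ζ lamW P).2.2.1.2 (b8LeafOfRecordSub_of_b8LeafOfRecord lam8 h8')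

end Record12B8subB13

/-! ## §5. Honesty, sharpened (dag-ref-B READ-373 (i)): the ZERO term tower with FULL spaces passes the typed [B13] leaf — no `Prop`-law on the residual layer's
fields makes `b13` contentful; only a term tower OF RECORD does -/

section HonestyUniv

variable (θ : Stage3Params)

/-- The all-zero letters (every real letter `0`, `L = q = 0`). [folklore] -/
private def zeroConsts : B13.Consts := ⟨0, 0, 0, 0, 0, 0, 0, 0, 0, 0, 0, 0, 0, 0, 0, 0, 0, 0, 0, 0, 0⟩

variable (c : B13.Consts)

/-- **The ZERO term tower with FULL spaces** (honesty witness): configurations `ℂ`, the spaces (1.34) ∕ p. 15 := `Set.univ`, one bond, NO terms (every index family empty, every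
term `0`), gauge-invariance clause := «invariant under EVERY map of the configuration space» (constancy: the strongest invariance clause, implying (I.3.29)'s),
`Repr17 := True`, `Restr := True`, letters `c` (arbitrary). [folklore] -/
private def zeroTowerUniv : ResidB13 θ where
  n := 0
  k := 0
  Φ := ℂ
  Bond := PUnit
  sp1 := fun _ => Set.univ
  sp2 := fun _ => Set.univ
  Bv := fun _ _ => 0
  S0 := fun _ => ∅
  F := fun _ _ => ∅
  Sq := fun _ _ _ => ∅
  SX := fun _ _ _ _ => ∅
  T := fun _ _ _ _ _ _ _ => 0
  Sc := fun _ => ∅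
  Sq' := fun _ _ _ => ∅
  SX' := fun _ _ _ _ => ∅
  T' := fun _ _ _ _ _ _ => 0
  Gl := fun _ _ => 0
  E := ℂ
  ι₂ := PUnit
  s := fun _ => ∅
  Wf := fun _ _ _ _ => 0
  g := 1
  e := fun _ _ => 0
  m₃ := 0
  T₃ := fun _ _ _ => 0
  Ek1 := fun _ _ => 0
  Elog := fun _ _ => 0
  GaugeInv := fun f => ∀ φ ψ, f φ = f ψ
  Repr17 := True
  Restr := True
  c := c

/-- The zero tower's V′_k(Y) is the zero function (sums over empty index families). [folklore] -/
private theorem zeroTowerUniv_Vp (Y : TDom 4 ((θ.ℓ₆ + 1) * ((zeroTowerUniv θ c).n + 1))) : (WtOfRecord θ (zeroTowerUniv θ c)).Vp Y = 0 := by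
  rw [WtOfRecord_Vp, show (zeroTowerUniv θ c).S0 Y = ∅ from rfl, show (zeroTowerUniv θ c).Sc Y = ∅ from rfl, Finset.sum_empty, Finset.sum_empty, add_zero]
  rfl

/-- The zero tower's V″_k(Y) is the zero function. [folklore] -/
private theorem zeroTowerUniv_Vpp (Y : TDom 4 ((θ.ℓ₆ + 1) * ((zeroTowerUniv θ c).n + 1))) : (WtOfRecord θ (zeroTowerUniv θ c)).Vpp Y = 0 := by
  rw [WtOfRecord_Vpp, zeroTowerUniv_Vp]
  funext φ
  exact add_zero (0 : ℂ)

/-- The zero tower's Q(Y, B, b, b′) vanishes. [folklore] -/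
private theorem zeroTowerUniv_Q (Y : TDom 4 ((θ.ℓ₆ + 1) * ((zeroTowerUniv θ c).n + 1))) (φ : (zeroTowerUniv θ c).Φ) (b b' : (zeroTowerUniv θ c).Bond) :
    (WtOfRecord θ (zeroTowerUniv θ c)).Q Y φ b b' = 0 := by
  rw [WtOfRecord_Q, show (zeroTowerUniv θ c).s Y = ∅ from rfl, Finset.sum_empty, mul_zero]

/-- The zero tower's V_k(Y) is the zero function. [folklore] -/
private theorem zeroTowerUniv_V (Y : TDom 4 ((θ.ℓ₆ + 1) * ((zeroTowerUniv θ c).n + 1))) : (WtOfRecord θ (zeroTowerUniv θ c)).V Y = 0 := by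
  rw [WtOfRecord_V, zeroTowerUniv_Vpp]
  funext φ
  rw [show (zeroTowerUniv θ c).s Y = ∅ from rfl, Finset.sum_empty]
  exact zero_add _

/-- The zero tower's quadratic form (1.42) vanishes. [folklore] -/
private theorem zeroTowerUniv_quadForm (Y : TDom 4 ((θ.ℓ₆ + 1) * ((zeroTowerUniv θ c).n + 1))) (φ : (zeroTowerUniv θ c).Φ) :
    (WtOfRecord θ (zeroTowerUniv θ c)).toStepData.quadForm Y φ = 0 := by
  show (1 / 2 : ℂ) * ∑ b : (zeroTowerUniv θ c).Bond, ∑ b' : (zeroTowerUniv θ c).Bond,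
      (WtOfRecord θ (zeroTowerUniv θ c)).Q Y φ b b' * (zeroTowerUniv θ c).Bv φ b * (zeroTowerUniv θ c).Bv φ b' = 0
  simp [zeroTowerUniv_Q]

/-- The zero tower's H(Z) vanishes (a sum of zero terms). [folklore] -/
private theorem zeroTowerUniv_H (Z : TDom 4 ((zeroTowerUniv θ c).n + 1)) (φ : (zeroTowerUniv θ c).Φ) : (WtOfRecord θ (zeroTowerUniv θ c)).H Z φ = 0 := by
  rw [WtOfRecord_H]
  exact Finset.sum_eq_zero fun _ _ => rfl

/-- **HONESTY, SHARPENED (dag-ref-B READ-373 (i)): NO law on the residual layer's OWN displayed fields makes `b13` contentful** — for ANY letters `c` whose three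
printed prefactors are non-negative (print's are positive), the ZERO term tower with FULL spaces `sp1 = sp2 = univ`, the STRONGEST invariance clause (constancy) and letters
`c` satisfies Lemma 1 ∧ Lemma 2 ∧ Lemma 3 AS TYPED at every `θ`: the sums (1.33) ∕ (1.41) ∕ (1.42) ∕ (2.9) of NO terms are the zero function (analytic, invariant), and
every printed bound reads `0 ≤ prefactor · exp(…)`.  So non-emptiness of the spaces, a genuine (I.3.29) clause, print's positive letters … do NOT exclude the junk inhabitant:
contentfulness of `b13` at a record = the IDENTIFICATION of the terms with the record's expansion ((1.25)–(1.33), (1.41), (2.9)–(2.14) applied to the record's effective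
actions — a `TermTowerOfRecord`, a CONSTRUCTION keyed on the record, NOT in the tree), not a `Prop`-law over `ResidB13`'s fields.
[cite: Balaban1988RG2Cluster, (1.33) p.9, (1.41)–(1.42) p.11, (2.9)–(2.14) pp.14–15 (the terms are the expansion's, in print)] -/
theorem exists_residB13_b13LeafOfRecord_univ_of_nonneg (h136 : 0 ≤ c.E₀ * c.ε₁ * c.C₁ * c.M ^ c.q) (h143 : 0 ≤ c.C₃ * c.ε₁ * c.M ^ 4)
    (h238 : 0 ≤ ({ c with L := θ.ℓ₆ + 1 } : B13.Consts).C3act * c.ε₁) :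
    ∃ lam : ResidB13 θ, lam.c = c ∧ (∀ Y, lam.sp1 Y = Set.univ) ∧ (∀ Z, lam.sp2 Z = Set.univ) ∧ (∀ f, lam.GaugeInv f ↔ ∀ φ ψ, f φ = f ψ) ∧ B13LeafOfRecord θ lam := by
  refine ⟨zeroTowerUniv θ c, rfl, fun _ => rfl, fun _ => rfl, fun _ => Iff.rfl, ⟨fun Y => ?_, fun Y φ _ => ?_⟩,
    ⟨fun Y => ?_, fun Y φ _ => ?_, fun Y φ b b' _ => ?_, fun Y φ _ => ?_, fun Y => ⟨fun φ ψ => ?_, fun φ ψ => ?_, fun φ ψ => ?_⟩⟩, fun _ Z φ _ => ?_⟩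
  · show (zeroTowerUniv θ c).Analytic ((WtOfRecord θ (zeroTowerUniv θ c)).Vp Y) Set.univ
    rw [zeroTowerUniv_Vp]; exact ResidB13.analytic_zero _ _
  · show ‖(WtOfRecord θ (zeroTowerUniv θ c)).Vp Y φ‖ ≤ _
    rw [zeroTowerUniv_Vp]
    show ‖(0 : ℂ)‖ ≤ _
    rw [norm_zero]
    exact mul_nonneg (mul_nonneg h136 (Real.exp_pos _).le) (Real.exp_pos _).le
  · show (zeroTowerUniv θ c).Analytic ((WtOfRecord θ (zeroTowerUniv θ c)).V Y) Set.univ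
    rw [zeroTowerUniv_V]; exact ResidB13.analytic_zero _ _
  · show (WtOfRecord θ (zeroTowerUniv θ c)).V Y φ = (WtOfRecord θ (zeroTowerUniv θ c)).toStepData.quadForm Y φ + (WtOfRecord θ (zeroTowerUniv θ c)).Vpp Y φ
    rw [zeroTowerUniv_V, zeroTowerUniv_quadForm, zeroTowerUniv_Vpp]
    exact (zero_add _).symm
  · show ‖(WtOfRecord θ (zeroTowerUniv θ c)).Q Y φ b b'‖ ≤ _
    rw [zeroTowerUniv_Q, norm_zero]
    exact mul_nonneg (mul_nonneg h143 (Real.exp_pos _).le) (Real.exp_pos _).le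
  · show ‖(WtOfRecord θ (zeroTowerUniv θ c)).Vpp Y φ‖ ≤ _
    rw [zeroTowerUniv_Vpp]
    show ‖(0 : ℂ)‖ ≤ _
    rw [norm_zero]
    exact mul_nonneg (mul_nonneg h136 (Real.exp_pos _).le) (Real.exp_pos _).le
  · show (WtOfRecord θ (zeroTowerUniv θ c)).V Y φ = (WtOfRecord θ (zeroTowerUniv θ c)).V Y ψ
    rw [zeroTowerUniv_V]; rfl
  · show (WtOfRecord θ (zeroTowerUniv θ c)).toStepData.quadForm Y φ = (WtOfRecord θ (zeroTowerUniv θ c)).toStepData.quadForm Y ψ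
    rw [zeroTowerUniv_quadForm, zeroTowerUniv_quadForm]
  · show (WtOfRecord θ (zeroTowerUniv θ c)).Vpp Y φ = (WtOfRecord θ (zeroTowerUniv θ c)).Vpp Y ψ
    rw [zeroTowerUniv_Vpp]; rfl
  · show ‖(WtOfRecord θ (zeroTowerUniv θ c)).H Z φ‖ ≤ _
    rw [zeroTowerUniv_H, norm_zero]
    exact mul_nonneg h238 (Real.exp_pos _).le

/-- … in particular (letters `0`): at EVERY `θ` some layer with FULL spaces and the constancy invariance clause satisfies the [B13] leaf of record.
[cite: Balaban1988RG2Cluster, (1.34) p.9 and p.15 (the spaces), Lemma 2 p.11 (the invariance clause)] -/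
theorem exists_residB13_b13LeafOfRecord_univ :
    ∃ lam : ResidB13 θ, (∀ Y, lam.sp1 Y = Set.univ) ∧ (∀ Z, lam.sp2 Z = Set.univ) ∧ (∀ f, lam.GaugeInv f ↔ ∀ φ ψ, f φ = f ψ) ∧ B13LeafOfRecord θ lam := by
  obtain ⟨lam, -, h⟩ := exists_residB13_b13LeafOfRecord_univ_of_nonneg θ zeroConsts (by simp [zeroConsts]) (by simp [zeroConsts]) (by simp [zeroConsts])
  exact ⟨lam, h⟩

variable (F : T4Family) (N : ℕ) [NeZero N]

/-- **HONESTY AT THE STAGE-12 RECORD, SHARPENED**: over EVERY admissible Stage-12 package with provisos there is a record world of §3 whose [B13] layer has FULL spaces and the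
constancy invariance clause and whose `b13` leaf nevertheless HOLDS at every run (the zero term tower) — so an «inhabited-at ∕ non-degenerate spaces» audit does NOT make the
N10 conjunct contentful at a record of this module; only a term tower OF RECORD (the identification with the record's expansion; not in the tree) does.
[cite: Balaban1988RG2Cluster, (1.33) p.9, (1.41)–(1.42) p.11, (2.9)–(2.14) pp.14–15 (the terms are the expansion's, in print)] -/
theorem exists_isRecordOfRecord₁₂CB10YZWB8B12B13_forall_b13_univ (θ : Stage12Params F N) (h : θ.Provisos₁₂ F N) (hθ : θ.Admissible F N) (Mstar : ℕ)
    (ops : OpsY N θ.toStage3Params Mstar) {γw : ℝ} (hγw : 0 < γw ∧ γw ≤ θ.γ) :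
    ∃ (lam13 : ResidB13 θ.toStage3Params) (lam12 : ResidB12 F N θ.τ9.M) (lam8 : ResidB8 θ.toStage3Params) (ζ : ResidZ F N) (lamW : ResidW F N) (w : WorldP),
      (∀ Y, lam13.sp1 Y = Set.univ) ∧ (∀ Z, lam13.sp2 Z = Set.univ) ∧ (∀ f, lam13.GaugeInv f ↔ ∀ φ ψ, f φ = f ψ) ∧
      (∀ P, w.up P = upOfRecord₅CS F N (θ.view₁₂B13B12B8B10YZW F N (fun _ => lam13) lam12 lam8 Mstar ops ζ lamW) P) ∧
      IsRecordOfRecord₁₂CB10YZWB8B12B13 F N (datumOfRecord₁₂ F N θ h) w ∧ w.γ = γw ∧ ∀ P : B12.RunParams, (leavesP w P).b13 := by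
  obtain ⟨lam13, h1, h2, hG, h13⟩ := exists_residB13_b13LeafOfRecord_univ θ.toStage3Params
  obtain ⟨lam12⟩ := nonempty_residB12 F N θ.τ9.M
  obtain ⟨lam8⟩ := nonempty_residB8 (θ := θ.toStage3Params)
  obtain ⟨ζ⟩ := nonempty_residZ (F := F) (N := N)
  obtain ⟨lamW⟩ := nonempty_residW (F := F) (N := N)
  obtain ⟨w₀, -, -⟩ := exists_world_isRecordOfRecord₁₂C F N θ h hθ hγw
  exact ⟨lam13, lam12, lam8, ζ, lamW, { w₀ with
      C := (datumOfRecord₁₂ F N θ h).C, γ := γw, L := (θ.L : ℝ), one_lt_L := by exact_mod_cast θ.hL.2,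
      up := fun P => upOfRecord₅CS F N (θ.view₁₂B13B12B8B10YZW F N (fun _ => lam13) lam12 lam8 Mstar ops ζ lamW) P },
    h1, h2, hG, fun _ => rfl, ⟨θ, h, fun _ => lam13, lam12, lam8, Mstar, ops, ζ, lamW, hθ, rfl, rfl, hγw, rfl, fun _ => rfl⟩, rfl, fun _ => h13⟩

end HonestyUniv


end Literature.MathematicalPhysics.QuantumFieldTheory.Balaban1983to89.Node00

end
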